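import Summits.RiemannHypothesis.RiemannHypothesis.Theorems.WeilAdversaryAdversaryTransferEnum
import Summits.RiemannHypothesis.RiemannHypothesis.Theses.WeilAdversary
import Literature.NumberTheory.LFunctions.AdversarialWeilPositivity
import Literature.NumberTheory.LFunctions.WeilCriterionConverse
import Literature.NumberTheory.LFunctions.WeilExplicitFormulaProofs
import Literature.NumberTheory.LFunctions.ZetaZerosProofs
import Literature.NumberTheory.LFunctions.ZetaArgVariation
import Literature.NumberTheory.LFunctions.RHWave0HardyProofs
import HarnessLib

/-!
# `WeilAdversary.AdversaryTransfer` (stmt-RiemannHypothesis-11224) — adversarial Weil positivity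
transfers to Weil positivity on `[-a, a]`

Route `WeilAdversary` (S5), support item, «provable now».  HONEST LABEL: a certificate-type TRANSFER
lemma of the WeilAdversary route — if every counting-admissible configuration `ρ : ℕ → ℂ` (open upper
half-strip, on the line below `T₀`, Riemann–von Mangoldt band above `T₀`) gives a non-negative
symmetrised zero side `Re ∑ₙ (k̂(ρₙ) + k̂(ρ̄ₙ)) ≥ 0` for every Weil test `g` supported in `[-a, a]`
(`k = g ⋆ g̃`), and RH holds up to `T₀`, and the true counting function `N(T)` lies in the band, then
`WeilPositivityOn a`.  0 toward RH: `WeilPositivityOn a` at fixed `a` carries no summit content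
(Bombieri 2000, bounded support is tower-blind), and the adversarial hypothesis is the route's crux.
Nothing here bears on the truth of RH.

**Proof.** Enumerate the TRUE non-trivial zeros with `Im ρ > 0`, each repeated `m(ρ)` times, as
`ρ : ℕ → ℂ` (`WeilAdversary.exists_enum_with_multiplicity`, `Theorems/WeilAdversaryAdversaryTransferEnum.lean`;
the set is countable — `riemannZetaNontrivialZeros_countable` — and infinite — Hardy,
`hardy_infinite_zeros_on_critical_line_holds`).  It is admissible: open strip
(`ZetaZeros.riemannZetaNontrivialZeros.mem_iff'`), on the line below `T₀` (hypothesis), locally finite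
with `#{n | Im ρₙ ≤ T} = ∑_{box} m(ρ) = N(T)` (`zetaZeroBox_finite`, `zetaZeroCount_eq_finsum`), hence
in the band (hypothesis).  So `0 ≤ Re ∑ₙ (k̂(ρₙ) + k̂(ρ̄ₙ))`.  Finally
`∑ₙ (k̂(ρₙ) + k̂(ρ̄ₙ)) = ∑_{Im ρ > 0} m(ρ) k̂(ρ) + ∑_{Im ρ > 0} m(ρ) k̂(ρ̄) = ∑_{ρ} m(ρ) k̂(ρ) = Q(g)`:
the enumeration lemma's `HasSum` clause twice (absolute convergence from
`IsWeilAdversary.summable_norm_weilMellin[_conj]`), conjugation is a multiplicity-preserving bijection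
from the upper onto the lower zeros (`riemannZetaZeroOrder_conj_holds`, no real non-trivial zeros:
`riemannZetaNontrivialZeros.im_ne_zero`), `k̂(ρ) = P_g(ρ)` (`weilMellin_weilQuadratic`), and the zero
form is `Q(g) = weilQuadratic g` (`hasWeilZeroSide_zeroForm` + `explicit_formula_holds`, uniqueness of
limits).
-/

-- `Summit.RiemannHypothesis.RiemannHypothesis.…` repeats a component by the tree's layout (D-0017).
set_option linter.dupNamespace false

noncomputable section

open Complex Set Filter Topology
open scoped ComplexConjugate

namespace Summit.RiemannHypothesis.RiemannHypothesis.Theorems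

open Literature.NumberTheory.LFunctions Literature.NumberTheory.LFunctions.WeilConverse
open Literature.NumberTheory.LFunctions.ZetaZeros (riemannZetaNontrivialZeros)

/-- The non-trivial zeros of `ζ` in the upper half-plane form an infinite set (Hardy 1914: infinitely
many zeros `½ + it`; `t ↦ -t` and `t = 0` account for the rest). -/
theorem WeilAdversary.upperZeros_infinite :
    {z : ℂ | z ∈ riemannZetaNontrivialZeros ∧ 0 < z.im}.Infinite := by
  intro hfin
  apply hardy_infinite_zeros_on_critical_line_holds
  refine ((hfin.image fun z ↦ z.im).union ((hfin.image fun z ↦ -z.im).union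
    (Set.finite_singleton (0 : ℝ)))).subset ?_
  intro t ht
  have ht' : riemannZeta (1 / 2 + t * I) = 0 := ht
  have him : ((1 : ℂ) / 2 + t * I).im = t := by simp
  rcases lt_trichotomy 0 t with hpos | hzero | hneg
  · left
    refine ⟨1 / 2 + t * I, ⟨?_, by rw [him]; exact hpos⟩, him⟩
    exact ZetaZeros.riemannZetaNontrivialZeros.mem_of_im_ne_zero ht' (by rw [him]; exact hpos.ne')
  · right; right
    rw [← hzero]
    rfl
  · right; left
    have hc : conj ((1 : ℂ) / 2 + t * I) = 1 / 2 + ((-t : ℝ) : ℂ) * I := by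
      apply Complex.ext <;> simp
    have him' : ((1 : ℂ) / 2 + ((-t : ℝ) : ℂ) * I).im = -t := by simp
    have hz : riemannZeta (1 / 2 + ((-t : ℝ) : ℂ) * I) = 0 := by
      rw [← hc, riemannZeta_conj, ht', map_zero]
    refine ⟨1 / 2 + ((-t : ℝ) : ℂ) * I, ⟨?_, by rw [him']; linarith⟩, by
      show -((1 : ℂ) / 2 + ((-t : ℝ) : ℂ) * I).im = t
      rw [him']
      ring⟩
    exact ZetaZeros.riemannZetaNontrivialZeros.mem_of_im_ne_zero hz (by rw [him']; linarith)

/-- The upper zeros up to height `T` are exactly the counting box `zetaZeroBox 0 T`. -/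
theorem WeilAdversary.upperZeros_inter_eq_zetaZeroBox (T : ℝ) :
    {z : ℂ | z ∈ riemannZetaNontrivialZeros ∧ 0 < z.im} ∩ {z | z.im ≤ T} = zetaZeroBox 0 T := by
  ext z
  constructor
  · rintro ⟨⟨hz, him⟩, hT⟩
    exact ⟨ZetaZeros.riemannZetaNontrivialZeros.zeta_eq_zero hz,
      (ZetaZeros.riemannZetaNontrivialZeros.re_pos hz).le,
      (ZetaZeros.riemannZetaNontrivialZeros.re_lt_one hz).le, him, hT⟩
  · intro h
    exact ⟨⟨zetaZeroBox_subset_riemannZetaNontrivialZeros 0 T h, h.2.2.2.1⟩, h.2.2.2.2⟩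

/-- Counting with multiplicity on a box gives `N(T)`:
`∑_{ρ upper zero, Im ρ ≤ T} m(ρ) = zetaZeroCount T` (in `ℕ`, with `m(ρ).toNat`). -/
theorem WeilAdversary.finsum_toNat_order_eq_zetaZeroCount (T : ℝ) :
    ∑ᶠ z ∈ {z : ℂ | z ∈ riemannZetaNontrivialZeros ∧ 0 < z.im} ∩ {z | z.im ≤ T},
        (riemannZetaZeroOrder z).toNat = zetaZeroCount T := by
  rw [WeilAdversary.upperZeros_inter_eq_zetaZeroBox]
  apply Nat.cast_injective (R := ℤ)
  have hB := zetaZeroBox_finite 0 T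
  rw [zetaZeroCount_eq_finsum, finsum_mem_eq_finite_toFinset_sum _ hB,
    finsum_mem_eq_finite_toFinset_sum _ hB, Nat.cast_sum]
  refine Finset.sum_congr rfl fun z hz ↦ ?_
  exact Int.toNat_of_nonneg (riemannZetaZeroOrder_nonneg_of_mem_zetaZeroBox (hB.mem_toFinset.1 hz))

/-- **`WeilAdversary.AdversaryTransfer` (stmt-RiemannHypothesis-11224).** For all `a, T₀, c₁, c₂, c₀`:
RH verified up to height `T₀` → the explicit Riemann–von Mangoldt band for the true `N(T)` above `T₀` →
adversarial Weil positivity `AdvPos(a; T₀; c₁, c₂, c₀)` → `WeilPositivityOn a`.  Instantiate the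
adversary at the true upper-half-plane zeros enumerated with multiplicity and identify its sum with
the zero side `Q(g)` of the explicit formula for `g ⋆ g̃`.  A transfer lemma; 0 toward RH. -/
theorem AdversaryTransfer_proof :
    Summit.RiemannHypothesis.RiemannHypothesis.Theses.WeilAdversary.AdversaryTransfer := by
  unfold Summit.RiemannHypothesis.RiemannHypothesis.Theses.WeilAdversary.AdversaryTransfer
  intro a T₀ c₁ c₂ c₀ hRH hN hAdv g hg hga
  have hAP : AdversarialWeilPositivity a T₀ c₁ c₂ c₀ := hAdv
  -- enumerate the upper zeros with multiplicity
  set U : Set ℂ := {z : ℂ | z ∈ riemannZetaNontrivialZeros ∧ 0 < z.im} with hU_def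
  set m : ℂ → ℕ := fun z ↦ (riemannZetaZeroOrder z).toNat with hm_def
  have hUc : U.Countable := riemannZetaNontrivialZeros_countable.mono fun z hz ↦ hz.1
  have hUi : U.Infinite := WeilAdversary.upperZeros_infinite
  have hm1 : ∀ z ∈ U, 1 ≤ m z := by
    intro z hz
    have h := ZetaZeros.riemannZetaNontrivialZeros.one_le_order hz.1
    simp only [hm_def]
    omega
  obtain ⟨ρ, hρU, hcount, hsum⟩ := WeilAdversary.exists_enum_with_multiplicity hUc hUi m hm1
  -- it is an admissible configuration for `(T₀; c₁, c₂, c₀)`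
  have hfinT : ∀ T : ℝ, (U ∩ {z | z.im ≤ T}).Finite := fun T ↦ by
    rw [hU_def, WeilAdversary.upperZeros_inter_eq_zetaZeroBox]
    exact zetaZeroBox_finite 0 T
  have hncard : ∀ T : ℝ, {n | (ρ n).im ≤ T}.ncard = zetaZeroCount T := fun T ↦ by
    rw [← WeilAdversary.finsum_toNat_order_eq_zetaZeroCount T]
    exact (hcount {z | z.im ≤ T} (hfinT T)).2
  have hρA : IsWeilAdversary T₀ c₁ c₂ c₀ ρ :=
    { strip := fun n ↦ by
        have h := ZetaZeros.riemannZetaNontrivialZeros.mem_iff'.1 (hρU n).1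
        exact ⟨h.2.1, h.2.2, (hρU n).2⟩
      on_line := fun n hn ↦
        hRH (ρ n) (ZetaZeros.riemannZetaNontrivialZeros.zeta_eq_zero (hρU n).1) (hρU n).2 hn
      finite := fun T ↦ (hcount {z | z.im ≤ T} (hfinT T)).1
      band := fun T hT ↦ by
        rw [hncard T]
        exact hN T hT }
  have hpos : 0 ≤ (∑' n, weilAdversaryTerm g (ρ n)).re := hAP.nonneg hρA hg hga
  -- identify the adversary sum with Weil's quadratic form
  set k : ℝ → ℂ := weilConv g (weilReflect g) with hk_def
  have hk : IsWeilTest k := hg.weilConv hg.weilReflect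
  have hs1 : Summable fun n ↦ weilMellin k (ρ n) := (hρA.summable_norm_weilMellin hk).of_norm
  have hs2 : Summable fun n ↦ weilMellin k (conj (ρ n)) :=
    (hρA.summable_norm_weilMellin_conj hk).of_norm
  -- (1) split the symmetrised term
  have h1 : ∑' n, weilAdversaryTerm g (ρ n) =
      ∑' n, weilMellin k (ρ n) + ∑' n, weilMellin k (conj (ρ n)) := by
    rw [show (fun n ↦ weilAdversaryTerm g (ρ n)) =
      fun n ↦ weilMellin k (ρ n) + weilMellin k (conj (ρ n)) from rfl]
    exact hs1.tsum_add hs2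
  -- (2) reindex both pieces over the upper zeros with multiplicity
  have h2 : ∑' n, weilMellin k (ρ n) = ∑' z : U, (m z : ℂ) * weilMellin k z :=
    ((hsum (weilMellin k) hs1).tsum_eq).symm
  have h3 : ∑' n, weilMellin k (conj (ρ n)) = ∑' z : U, (m z : ℂ) * weilMellin k (conj z) :=
    ((hsum (fun z ↦ weilMellin k (conj z)) hs2).tsum_eq).symm
  -- (3) the zero side over all non-trivial zeros, split into upper and lower zeros
  set G : riemannZetaNontrivialZeros → ℂ :=
    fun x ↦ (riemannZetaZeroOrder (x : ℂ) : ℂ) * weilMellin k x with hG_def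
  have hGeq : (fun x : riemannZetaNontrivialZeros ↦
      (riemannZetaZeroOrder (x : ℂ) : ℂ) * pairCoeff g x) = G := by
    funext x
    simp only [hG_def, hk_def]
    rw [weilMellin_weilQuadratic hg, pairCoeff]
  have hGs : Summable G := hGeq ▸ summable_pairCoeff hg
  have hzero : zeroForm g = ∑' x, G x := by
    unfold zeroForm
    rw [hGeq]
  set P : Set riemannZetaNontrivialZeros := {x | 0 < (x : ℂ).im} with hP_def
  have hsplit : ∑' x : P, G x + ∑' x : (Pᶜ : Set riemannZetaNontrivialZeros), G x = ∑' x, G x :=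
    hGs.tsum_subtype_add_tsum_subtype_compl P
  -- multiplicities as naturals
  have hmz : ∀ z ∈ riemannZetaNontrivialZeros, ((m z : ℕ) : ℂ) = (riemannZetaZeroOrder z : ℂ) := by
    intro z hz
    have h0 : 0 ≤ riemannZetaZeroOrder z :=
      riemannZetaZeroOrder_nonneg (ZetaZeros.riemannZetaNontrivialZeros.ne_one hz)
    calc ((m z : ℕ) : ℂ) = (((riemannZetaZeroOrder z).toNat : ℤ) : ℂ) := (Int.cast_natCast _).symm
      _ = (riemannZetaZeroOrder z : ℂ) := by rw [Int.toNat_of_nonneg h0]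
  -- (4) upper zeros: `↥U ≃ ↥P`
  set e₁ : U ≃ P :=
    { toFun := fun z ↦ ⟨⟨z.1, z.2.1⟩, z.2.2⟩
      invFun := fun x ↦ ⟨x.1.1, ⟨x.1.2, x.2⟩⟩
      left_inv := fun z ↦ rfl
      right_inv := fun x ↦ rfl } with he₁
  have h4 : ∑' x : P, G x = ∑' z : U, (m z : ℂ) * weilMellin k z := by
    rw [← Equiv.tsum_eq e₁]
    refine tsum_congr fun z ↦ ?_
    show (riemannZetaZeroOrder (z : ℂ) : ℂ) * weilMellin k z = _
    rw [hmz z z.2.1]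
  -- (5) lower zeros: conjugation `↥U ≃ ↥Pᶜ`
  set e₂ : U ≃ (Pᶜ : Set riemannZetaNontrivialZeros) :=
    { toFun := fun z ↦ ⟨⟨conj z.1, ZetaZeros.riemannZetaNontrivialZeros.conj_mem z.2.1⟩, by
        show ¬ (0 < (conj (z : ℂ)).im)
        rw [Complex.conj_im]
        linarith [z.2.2]⟩
      invFun := fun x ↦ ⟨conj x.1.1, ⟨ZetaZeros.riemannZetaNontrivialZeros.conj_mem x.1.2, by
        have hne := ZetaZeros.riemannZetaNontrivialZeros.im_ne_zero x.1.2
        have hx : ¬ (0 < (x.1 : ℂ).im) := x.2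
        rw [Complex.conj_im]
        push Not at hx
        exact neg_pos.2 (lt_of_le_of_ne hx hne)⟩⟩
      left_inv := fun z ↦ by
        apply Subtype.ext
        exact Complex.conj_conj _
      right_inv := fun x ↦ by
        apply Subtype.ext
        apply Subtype.ext
        exact Complex.conj_conj _ } with he₂
  have h5 : ∑' x : (Pᶜ : Set riemannZetaNontrivialZeros), G x =
      ∑' z : U, (m z : ℂ) * weilMellin k (conj z) := by
    rw [← Equiv.tsum_eq e₂]
    refine tsum_congr fun z ↦ ?_
    show (riemannZetaZeroOrder (conj (z : ℂ)) : ℂ) * weilMellin k (conj (z : ℂ)) = _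
    rw [riemannZetaZeroOrder_conj_holds, hmz z z.2.1]
  -- (6) the zero form is Weil's quadratic form (explicit formula + uniqueness of limits)
  have hzq : zeroForm g = weilQuadratic g :=
    tendsto_nhds_unique (hasWeilZeroSide_zeroForm hg) (explicit_formula_holds hk)
  have hid : ∑' n, weilAdversaryTerm g (ρ n) = weilQuadratic g := by
    rw [h1, h2, h3, ← h4, ← h5, hsplit, ← hzero, hzq]
  rw [← hid]
  exact hpos

end Summit.RiemannHypothesis.RiemannHypothesis.Theorems

end
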